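import Mathlib
import HarnessLib
import Summits.KontsevichZagierPeriods.Zeta5Search.BarnesEulerIntegral
import Literature.Analysis.SpecialFunctions.GammaStirlingVertical

/-!
# ζ(5) search — decay of the Barnes kernel `Γ(a₀+s)Γ(a+s)Γ(−s)/Γ(b+s)` on a vertical line (cell `pub-zeta5`, ct-1 g27)

HONEST FRAMING: systematic search; no irrationality claim unless kernel-certified.  Estimates for a special function;
nothing here is an irrationality result, a worthiness exponent or a denominator statement; no named fact is discharged.

First third of brick B2-on-the-cut of the lineage's blueprint `HOME/ct-1/g26/VWP-BLUEPRINT.md` for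
`Zudilin2002.vwp_eq_integral_of_pos` (Nesterenko's Lemma 2 = Zudilin math/0206177 Lemma 2 for `0 < z ≤ 1`).  On the cut the
Barnes kernel of ct-1 g26's `BarnesEulerIntegral.eulerIntegral_neg_eq_barnes`,

  `K(y) = Γ(a₀+s)Γ(a+s)Γ(−s)/Γ(b+s)`, `s = −t₀ + iy`,

is multiplied by `z^{s}e^{±iπs}`, of modulus `z^{−t₀}e^{∓πy}`, so the absolute convergence of the Barnes integral rests on the
exact Stirling order of `K`: from the two-sided vertical Stirling bounds of
`Literature.Analysis.SpecialFunctions.GammaStirlingVertical` (`exists_norm_Gamma_vertical_le/ge`), with the imaginary shifts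
`Im a₀, Im a, Im b` absorbed (`abs_add_rpow_le`),

* `norm_kernel_le` — `‖K(y)‖ ≤ C |y|^{Re a₀ + Re a − Re b − 1} e^{−π|y|}` for `|y| ≥ R` (no hypothesis on the parameters: far out
  on the line there are no poles);
* `continuous_kernel` — continuity on the line for `0 < t₀ < Re a₀`, `t₀ < Re a`, `t₀ < Re b`;
* `integrable_kernel_mul_exp` — for `θ < π`, `y ↦ K(y)·((1+|y|)·M e^{θ|y|})` is integrable (the majorant for differentiation
  under the integral sign off the cut, where `|arg w| ≤ θ < π`);
* `integrable_norm_kernel_mul_exp_pi` — `y ↦ ‖K(y)‖ e^{π|y|}` is integrable when moreover `Re a₀ + Re a < Re b` (the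
  majorant ON the cut; this is exactly where the printed hypothesis `Re b > Re a₀ + Re a` of Lemma 2 enters).

Theorems only (no definitions); imports `Zeta5Search/BarnesEulerIntegral` (for `BarnesMellin`'s elementary helpers) and
`Literature.Analysis.SpecialFunctions.GammaStirlingVertical`.
-/

noncomputable section

namespace Summit.KontsevichZagierPeriods.Zeta5Search.BarnesKernelBounds

open MeasureTheory Set Filter
open scoped Real
open Literature.Analysis.SpecialFunctions.GammaStirling (exists_norm_Gamma_vertical_le exists_norm_Gamma_vertical_ge)
open Summit.KontsevichZagierPeriods.Zeta5Search.BarnesMellin (ne_neg_nat_of_re_pos integrable_of_norm_le_exp)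

variable {t₀ : ℝ} {a₀ a b : ℂ}

/-! ### 1. Shifted Stirling bounds on the line `s = −t₀ + iy` -/

/-- Elementary: for `|y| ≥ 2|β| + 2` the shifted ordinate satisfies `1 ≤ |β + y|` and
`|β + y|^q ≤ 2^{|q|} |y|^q` for every real exponent `q` (both signs). -/
theorem abs_add_rpow_le (β q : ℝ) {y : ℝ} (hy : 2 * |β| + 2 ≤ |y|) :
    1 ≤ |β + y| ∧ |β + y| ^ q ≤ (2 : ℝ) ^ |q| * |y| ^ q := by
  have hβ := abs_nonneg β
  have h1 : |y| - |β| ≤ |β + y| := by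
    have h := abs_sub (β + y) β
    rw [add_sub_cancel_left] at h
    linarith
  have h2 : |β + y| ≤ |β| + |y| := abs_add_le β y
  have hlow : |y| / 2 ≤ |β + y| := by linarith
  have hup : |β + y| ≤ 2 * |y| := by linarith
  have hy0 : 0 < |y| := by linarith
  refine ⟨by linarith, ?_⟩
  rcases le_or_gt 0 q with hq | hq
  · rw [abs_of_nonneg hq]
    calc |β + y| ^ q ≤ (2 * |y|) ^ q := Real.rpow_le_rpow (abs_nonneg _) hup hq
      _ = (2 : ℝ) ^ q * |y| ^ q := Real.mul_rpow (by norm_num) (abs_nonneg y)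
  · rw [abs_of_neg hq]
    calc |β + y| ^ q ≤ (|y| / 2) ^ q := Real.rpow_le_rpow_of_nonpos (by positivity) hlow hq.le
      _ = |y| ^ q / (2 : ℝ) ^ q := Real.div_rpow (abs_nonneg y) (by norm_num) q
      _ = (2 : ℝ) ^ (-q) * |y| ^ q := by
          rw [Real.rpow_neg (by norm_num : (0 : ℝ) ≤ 2), div_eq_mul_inv, mul_comm]

/-- The point `c + s`, `s = −t₀ + iy`, in the form `x + iu` with real `x = Re c − t₀`, `u = Im c + y`. -/
theorem add_line_eq (c : ℂ) (t₀ y : ℝ) :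
    c + (-(t₀ : ℂ) + (y : ℂ) * Complex.I) = ((c.re - t₀ : ℝ) : ℂ) + ((c.im + y : ℝ) : ℂ) * Complex.I := by
  apply Complex.ext <;> simp [sub_eq_add_neg]

/-- **Shifted upper Stirling bound**: for every complex `c` and real `t₀` there are `C > 0`, `R ≥ 1` with
`‖Γ(c + s)‖ ≤ C |y|^{Re c − t₀ − 1/2} e^{−π|y|/2}` for `|y| ≥ R`, `s = −t₀ + iy`. -/
theorem norm_Gamma_shift_le (c : ℂ) (t₀ : ℝ) :
    ∃ C : ℝ, 0 < C ∧ ∃ R : ℝ, 1 ≤ R ∧ ∀ y : ℝ, R ≤ |y| →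
      ‖Complex.Gamma (c + (-(t₀ : ℂ) + (y : ℂ) * Complex.I))‖ ≤
        C * |y| ^ (c.re - t₀ - 1 / 2) * Real.exp (-(π * |y|) / 2) := by
  obtain ⟨C₁, hC₁, h₁⟩ := exists_norm_Gamma_vertical_le (c.re - t₀) (c.re - t₀)
  refine ⟨C₁ * (2 : ℝ) ^ |c.re - t₀ - 1 / 2| * Real.exp (π * |c.im| / 2), by positivity, 2 * |c.im| + 2,
    by linarith [abs_nonneg c.im], fun y hy => ?_⟩
  obtain ⟨hu1, hpow⟩ := abs_add_rpow_le c.im (c.re - t₀ - 1 / 2) hy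
  have hlow : |y| - |c.im| ≤ |c.im + y| := by
    have h := abs_sub (c.im + y) c.im
    rw [add_sub_cancel_left] at h
    linarith
  have hΓ := h₁ (c.re - t₀) (by simp) (c.im + y) hu1
  have hexp : Real.exp (-(π * |c.im + y|) / 2) ≤ Real.exp (π * |c.im| / 2) * Real.exp (-(π * |y|) / 2) := by
    rw [← Real.exp_add]
    apply Real.exp_le_exp.2
    have := mul_le_mul_of_nonneg_left hlow Real.pi_pos.le
    linarith
  rw [add_line_eq]
  calc ‖Complex.Gamma (((c.re - t₀ : ℝ) : ℂ) + ((c.im + y : ℝ) : ℂ) * Complex.I)‖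
      ≤ C₁ * |c.im + y| ^ (c.re - t₀ - 1 / 2) * Real.exp (-(π * |c.im + y|) / 2) := hΓ
    _ ≤ C₁ * ((2 : ℝ) ^ |c.re - t₀ - 1 / 2| * |y| ^ (c.re - t₀ - 1 / 2)) *
          (Real.exp (π * |c.im| / 2) * Real.exp (-(π * |y|) / 2)) := by gcongr
    _ = _ := by ring

/-- **Shifted lower Stirling bound, reciprocal form**: for every complex `c` and real `t₀` there are `C > 0`, `R ≥ 1` with
`‖Γ(c + s)‖⁻¹ ≤ C |y|^{−(Re c − t₀ − 1/2)} e^{π|y|/2}` for `|y| ≥ R`, `s = −t₀ + iy` (far out on the line `Γ` has no zeros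
and no poles, and `1/Γ` grows at most like the reciprocal of Stirling's lower bound). -/
theorem norm_Gamma_shift_inv_le (c : ℂ) (t₀ : ℝ) :
    ∃ C : ℝ, 0 < C ∧ ∃ R : ℝ, 1 ≤ R ∧ ∀ y : ℝ, R ≤ |y| →
      ‖Complex.Gamma (c + (-(t₀ : ℂ) + (y : ℂ) * Complex.I))‖⁻¹ ≤
        C * |y| ^ (-(c.re - t₀ - 1 / 2)) * Real.exp (π * |y| / 2) := by
  obtain ⟨c₁, hc₁, h₁⟩ := exists_norm_Gamma_vertical_ge (c.re - t₀) (c.re - t₀)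
  refine ⟨c₁⁻¹ * (2 : ℝ) ^ |-(c.re - t₀ - 1 / 2)| * Real.exp (π * |c.im| / 2), by positivity, 2 * |c.im| + 2,
    by linarith [abs_nonneg c.im], fun y hy => ?_⟩
  obtain ⟨hu1, hpow⟩ := abs_add_rpow_le c.im (-(c.re - t₀ - 1 / 2)) hy
  have hup : |c.im + y| ≤ |c.im| + |y| := abs_add_le _ _
  have hu0 : 0 < |c.im + y| := by linarith
  have hΓ := h₁ (c.re - t₀) (by simp) (c.im + y) hu1
  have hpos : 0 < c₁ * |c.im + y| ^ (c.re - t₀ - 1 / 2) * Real.exp (-(π * |c.im + y|) / 2) :=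
    mul_pos (mul_pos hc₁ (Real.rpow_pos_of_pos hu0 _)) (Real.exp_pos _)
  have hinv := inv_anti₀ hpos hΓ
  have hrew : (c₁ * |c.im + y| ^ (c.re - t₀ - 1 / 2) * Real.exp (-(π * |c.im + y|) / 2))⁻¹ =
      c₁⁻¹ * |c.im + y| ^ (-(c.re - t₀ - 1 / 2)) * Real.exp (π * |c.im + y| / 2) := by
    rw [mul_inv, mul_inv, Real.rpow_neg hu0.le, ← Real.exp_neg]
    congr 2
    ring
  have hexp : Real.exp (π * |c.im + y| / 2) ≤ Real.exp (π * |c.im| / 2) * Real.exp (π * |y| / 2) := by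
    rw [← Real.exp_add]
    apply Real.exp_le_exp.2
    have := mul_le_mul_of_nonneg_left hup Real.pi_pos.le
    linarith
  rw [add_line_eq]
  calc ‖Complex.Gamma (((c.re - t₀ : ℝ) : ℂ) + ((c.im + y : ℝ) : ℂ) * Complex.I)‖⁻¹
      ≤ (c₁ * |c.im + y| ^ (c.re - t₀ - 1 / 2) * Real.exp (-(π * |c.im + y|) / 2))⁻¹ := hinv
    _ = c₁⁻¹ * |c.im + y| ^ (-(c.re - t₀ - 1 / 2)) * Real.exp (π * |c.im + y| / 2) := hrew
    _ ≤ c₁⁻¹ * ((2 : ℝ) ^ |-(c.re - t₀ - 1 / 2)| * |y| ^ (-(c.re - t₀ - 1 / 2))) *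
          (Real.exp (π * |c.im| / 2) * Real.exp (π * |y| / 2)) := by gcongr
    _ = _ := by ring

/-- Stirling for the factor `Γ(−s) = Γ(t₀ − iy)`: `‖Γ(−s)‖ ≤ C |y|^{t₀ − 1/2} e^{−π|y|/2}` for `|y| ≥ 1`. -/
theorem norm_Gamma_neg_line_le (t₀ : ℝ) :
    ∃ C : ℝ, 0 < C ∧ ∀ y : ℝ, 1 ≤ |y| →
      ‖Complex.Gamma (-(-(t₀ : ℂ) + (y : ℂ) * Complex.I))‖ ≤ C * |y| ^ (t₀ - 1 / 2) * Real.exp (-(π * |y|) / 2) := by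
  obtain ⟨C, hC, h⟩ := exists_norm_Gamma_vertical_le t₀ t₀
  refine ⟨C, hC, fun y hy => ?_⟩
  have hrew : -(-(t₀ : ℂ) + (y : ℂ) * Complex.I) = (t₀ : ℂ) + ((-y : ℝ) : ℂ) * Complex.I := by
    push_cast; ring
  have := h t₀ (by simp) (-y) (by simpa using hy)
  rw [hrew]
  simpa [abs_neg] using this

/-! ### 2. The kernel: decay, continuity, majorants -/

/-- **Decay of the Barnes kernel on the line** `s = −t₀ + iy`: there are `C > 0`, `R ≥ 1` with
`‖Γ(a₀+s)Γ(a+s)Γ(−s)/Γ(b+s)‖ ≤ C |y|^{Re a₀ + Re a − Re b − 1} e^{−π|y|}` for `|y| ≥ R` (four vertical Stirling bounds;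
the exponents `(Re a₀−t₀−½) + (Re a−t₀−½) + (t₀−½) − (Re b−t₀−½)` add up to `Re a₀ + Re a − Re b − 1`). -/
theorem norm_kernel_le (a₀ a b : ℂ) (t₀ : ℝ) :
    ∃ C : ℝ, 0 < C ∧ ∃ R : ℝ, 1 ≤ R ∧ ∀ y : ℝ, R ≤ |y| →
      ‖Complex.Gamma (a₀ + (-(t₀ : ℂ) + (y : ℂ) * Complex.I)) * Complex.Gamma (a + (-(t₀ : ℂ) + (y : ℂ) * Complex.I)) *
            Complex.Gamma (-(-(t₀ : ℂ) + (y : ℂ) * Complex.I)) /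
          Complex.Gamma (b + (-(t₀ : ℂ) + (y : ℂ) * Complex.I))‖ ≤
        C * |y| ^ (a₀.re + a.re - b.re - 1) * Real.exp (-(π * |y|)) := by
  obtain ⟨C₁, hC₁, R₁, hR₁, h₁⟩ := norm_Gamma_shift_le a₀ t₀
  obtain ⟨C₂, hC₂, R₂, hR₂, h₂⟩ := norm_Gamma_shift_le a t₀
  obtain ⟨C₃, hC₃, h₃⟩ := norm_Gamma_neg_line_le t₀
  obtain ⟨C₄, hC₄, R₄, hR₄, h₄⟩ := norm_Gamma_shift_inv_le b t₀
  refine ⟨C₁ * C₂ * C₃ * C₄, by positivity, max (max R₁ R₂) R₄,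
    le_max_of_le_left (le_max_of_le_left hR₁), fun y hy => ?_⟩
  have hy₁ : R₁ ≤ |y| := le_trans (le_max_of_le_left (le_max_left _ _)) hy
  have hy₂ : R₂ ≤ |y| := le_trans (le_max_of_le_left (le_max_right _ _)) hy
  have hy₄ : R₄ ≤ |y| := le_trans (le_max_right _ _) hy
  have hy1 : 1 ≤ |y| := le_trans hR₁ hy₁
  have hy0 : 0 < |y| := by linarith
  have g1 := h₁ y hy₁
  have g2 := h₂ y hy₂
  have g3 := h₃ y hy1
  have g4 := h₄ y hy₄
  set E : ℝ := Real.exp (-(π * |y|) / 2) with hE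
  have hP : |y| ^ (a₀.re - t₀ - 1 / 2) * |y| ^ (a.re - t₀ - 1 / 2) * |y| ^ (t₀ - 1 / 2) *
      |y| ^ (-(b.re - t₀ - 1 / 2)) = |y| ^ (a₀.re + a.re - b.re - 1) := by
    rw [← Real.rpow_add hy0, ← Real.rpow_add hy0, ← Real.rpow_add hy0]
    congr 1
    ring
  have hEE : E * E * E * Real.exp (π * |y| / 2) = Real.exp (-(π * |y|)) := by
    rw [hE, ← Real.exp_add, ← Real.exp_add, ← Real.exp_add]
    congr 1
    ring
  rw [norm_div, norm_mul, norm_mul, div_eq_mul_inv]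
  calc ‖Complex.Gamma (a₀ + (-(t₀ : ℂ) + (y : ℂ) * Complex.I))‖ * ‖Complex.Gamma (a + (-(t₀ : ℂ) + (y : ℂ) * Complex.I))‖ *
          ‖Complex.Gamma (-(-(t₀ : ℂ) + (y : ℂ) * Complex.I))‖ * ‖Complex.Gamma (b + (-(t₀ : ℂ) + (y : ℂ) * Complex.I))‖⁻¹
      ≤ (C₁ * |y| ^ (a₀.re - t₀ - 1 / 2) * E) * (C₂ * |y| ^ (a.re - t₀ - 1 / 2) * E) * (C₃ * |y| ^ (t₀ - 1 / 2) * E) *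
          (C₄ * |y| ^ (-(b.re - t₀ - 1 / 2)) * Real.exp (π * |y| / 2)) :=
        mul_le_mul (mul_le_mul (mul_le_mul g1 g2 (norm_nonneg _) (by positivity)) g3 (norm_nonneg _) (by positivity))
          g4 (by positivity) (by positivity)
    _ = (C₁ * C₂ * C₃ * C₄) * (|y| ^ (a₀.re - t₀ - 1 / 2) * |y| ^ (a.re - t₀ - 1 / 2) * |y| ^ (t₀ - 1 / 2) *
          |y| ^ (-(b.re - t₀ - 1 / 2))) * (E * E * E * Real.exp (π * |y| / 2)) := by ring
    _ = (C₁ * C₂ * C₃ * C₄) * |y| ^ (a₀.re + a.re - b.re - 1) * Real.exp (-(π * |y|)) := by rw [hP, hEE]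

/-- **Continuity of the kernel** on the line: for `0 < t₀ < Re a₀`, `t₀ < Re a`, `t₀ < Re b` no Gamma factor meets a pole
and the denominator does not vanish. -/
theorem continuous_kernel (ht₀ : 0 < t₀) (ht₀' : t₀ < a₀.re) (hta : t₀ < a.re) (htb : t₀ < b.re) :
    Continuous fun y : ℝ =>
      Complex.Gamma (a₀ + (-(t₀ : ℂ) + (y : ℂ) * Complex.I)) * Complex.Gamma (a + (-(t₀ : ℂ) + (y : ℂ) * Complex.I)) *
          Complex.Gamma (-(-(t₀ : ℂ) + (y : ℂ) * Complex.I)) /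
        Complex.Gamma (b + (-(t₀ : ℂ) + (y : ℂ) * Complex.I)) := by
  have hΓ : ∀ (f : ℝ → ℂ), Continuous f → (∀ y, 0 < (f y).re) → Continuous fun y => Complex.Gamma (f y) := by
    intro f hf hpos
    refine continuous_iff_continuousAt.mpr fun y => (Complex.continuousAt_Gamma _ ?_).comp hf.continuousAt
    exact ne_neg_nat_of_re_pos (hpos y)
  have h1 := hΓ (fun y : ℝ => a₀ + (-(t₀ : ℂ) + (y : ℂ) * Complex.I)) (by fun_prop) (fun y => by simp; linarith)
  have h2 := hΓ (fun y : ℝ => a + (-(t₀ : ℂ) + (y : ℂ) * Complex.I)) (by fun_prop) (fun y => by simp; linarith)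
  have h3 := hΓ (fun y : ℝ => -(-(t₀ : ℂ) + (y : ℂ) * Complex.I)) (by fun_prop) (fun y => by simp [ht₀])
  have h4 := hΓ (fun y : ℝ => b + (-(t₀ : ℂ) + (y : ℂ) * Complex.I)) (by fun_prop) (fun y => by simp; linarith)
  refine ((h1.mul h2).mul h3).div h4 fun y => ?_
  exact Complex.Gamma_ne_zero_of_re_pos (by simp; linarith)

/-- **Majorant off the cut**: for `θ < π` and any constant `M`, the function `y ↦ K(y)·((1+|y|)·M·e^{θ|y|})` (complex-valued,
the real weight cast into `ℂ`) is integrable on `ℝ` — the kernel's `e^{−π|y|}` beats `e^{θ|y|}` times any polynomial.  Its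
norm dominates both `K(y) w^{s}` and the `w`-derivative `K(y)·s·w^{s−1}` for `|arg w| ≤ θ`, `‖w‖` bounded below. -/
theorem integrable_kernel_mul_exp (ht₀ : 0 < t₀) (ht₀' : t₀ < a₀.re) (hta : t₀ < a.re) (htb : t₀ < b.re) {θ : ℝ}
    (hθ : θ < π) (M : ℝ) :
    Integrable fun y : ℝ =>
      Complex.Gamma (a₀ + (-(t₀ : ℂ) + (y : ℂ) * Complex.I)) * Complex.Gamma (a + (-(t₀ : ℂ) + (y : ℂ) * Complex.I)) *
            Complex.Gamma (-(-(t₀ : ℂ) + (y : ℂ) * Complex.I)) /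
          Complex.Gamma (b + (-(t₀ : ℂ) + (y : ℂ) * Complex.I)) *
        (((1 + |y|) * (M * Real.exp (θ * |y|)) : ℝ) : ℂ) := by
  obtain ⟨C, hC, R, hR, hK⟩ := norm_kernel_le a₀ a b t₀
  -- polynomial × e^{-(π-θ)|y|/2} is eventually ≤ 1/(C(|M|+1))
  set p : ℝ := max (a₀.re + a.re - b.re - 1) 0 + 1 with hp
  have hp0 : 0 ≤ p := by positivity
  have hδ : 0 < (π - θ) / 2 := by linarith
  obtain ⟨T₀, hT₀⟩ := Literature.Analysis.Complex.exists_rpow_mul_exp_neg_le (K := 1) zero_le_one hp0 hδ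
    (ε := (C * (|M| + 1))⁻¹) (by positivity)
  refine integrable_of_norm_le_exp ((continuous_kernel ht₀ ht₀' hta htb).mul (by fun_prop)) hδ (C := 1)
    (R := max R T₀) fun y hy => ?_
  have hyR : R ≤ |y| := le_trans (le_max_left _ _) hy
  have hyT : T₀ ≤ |y| := le_trans (le_max_right _ _) hy
  have hy1 : 1 ≤ |y| := le_trans hR hyR
  have hy0 : 0 < |y| := by linarith
  have hKy := hK y hyR
  have hTy := hT₀ y hyT
  -- the real weight
  have hw : ‖((((1 + |y|) * (M * Real.exp (θ * |y|)) : ℝ) : ℂ))‖ ≤ (1 + |y|) * ((|M| + 1) * Real.exp (θ * |y|)) := by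
    rw [Complex.norm_real, Real.norm_eq_abs, abs_mul, abs_mul, abs_of_nonneg (by positivity : (0 : ℝ) ≤ 1 + |y|),
      Real.abs_exp]
    gcongr
    linarith
  -- |y|^q ≤ (1+|y|)^{max q 0}
  have hq : |y| ^ (a₀.re + a.re - b.re - 1) ≤ (1 + |y|) ^ (max (a₀.re + a.re - b.re - 1) 0) :=
    BarnesMellinCpow.rpow_le_add_rpow_max hy1 zero_le_one
  have hpoly : (1 + |y|) ^ (max (a₀.re + a.re - b.re - 1) 0) * (1 + |y|) = (1 + |y|) ^ p := by
    rw [hp, Real.rpow_add (by linarith), Real.rpow_one]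
  have hexp : Real.exp (-(π * |y|)) * Real.exp (θ * |y|) =
      Real.exp (-((π - θ) / 2 * |y|)) * Real.exp (-((π - θ) / 2) * |y|) := by
    rw [← Real.exp_add, ← Real.exp_add]; ring_nf
  rw [norm_mul]
  calc ‖Complex.Gamma (a₀ + (-(t₀ : ℂ) + (y : ℂ) * Complex.I)) * Complex.Gamma (a + (-(t₀ : ℂ) + (y : ℂ) * Complex.I)) *
            Complex.Gamma (-(-(t₀ : ℂ) + (y : ℂ) * Complex.I)) /
          Complex.Gamma (b + (-(t₀ : ℂ) + (y : ℂ) * Complex.I))‖ *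
        ‖((((1 + |y|) * (M * Real.exp (θ * |y|)) : ℝ) : ℂ))‖
      ≤ (C * |y| ^ (a₀.re + a.re - b.re - 1) * Real.exp (-(π * |y|))) *
          ((1 + |y|) * ((|M| + 1) * Real.exp (θ * |y|))) :=
        mul_le_mul hKy hw (norm_nonneg _) (by positivity)
    _ ≤ (C * (1 + |y|) ^ (max (a₀.re + a.re - b.re - 1) 0) * Real.exp (-(π * |y|))) *
          ((1 + |y|) * ((|M| + 1) * Real.exp (θ * |y|))) := by gcongr
    _ = (C * (|M| + 1)) * (((1 + |y|) ^ (max (a₀.re + a.re - b.re - 1) 0) * (1 + |y|)) *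
          (Real.exp (-(π * |y|)) * Real.exp (θ * |y|))) := by ring
    _ = (C * (|M| + 1)) * ((1 + |y|) ^ p * Real.exp (-((π - θ) / 2 * |y|))) * Real.exp (-((π - θ) / 2) * |y|) := by
        rw [hpoly, hexp]; ring
    _ ≤ (C * (|M| + 1)) * (C * (|M| + 1))⁻¹ * Real.exp (-((π - θ) / 2) * |y|) := by
        gcongr
    _ = 1 * Real.exp (-((π - θ) / 2) * |y|) := by rw [mul_inv_cancel₀ (by positivity)]

/-- **Majorant on the cut**: if moreover `Re a₀ + Re a < Re b`, then `y ↦ ‖K(y)‖ e^{π|y|}` is integrable on `ℝ`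
(tail `≍ |y|^{Re a₀ + Re a − Re b − 1}`, an integrable power exactly under this hypothesis; compare Mathlib's
`integrable_one_add_norm`).  This dominates `K(y)·x^{s}e^{±iπs}` for `0 < x ≤ 1` and the approach to the cut. -/
theorem integrable_norm_kernel_mul_exp_pi (ht₀ : 0 < t₀) (ht₀' : t₀ < a₀.re) (hta : t₀ < a.re) (htb : t₀ < b.re)
    (hb : a₀.re + a.re < b.re) :
    Integrable fun y : ℝ =>
      ‖Complex.Gamma (a₀ + (-(t₀ : ℂ) + (y : ℂ) * Complex.I)) * Complex.Gamma (a + (-(t₀ : ℂ) + (y : ℂ) * Complex.I)) *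
            Complex.Gamma (-(-(t₀ : ℂ) + (y : ℂ) * Complex.I)) /
          Complex.Gamma (b + (-(t₀ : ℂ) + (y : ℂ) * Complex.I))‖ * Real.exp (π * |y|) := by
  obtain ⟨C, hC, R, hR, hK⟩ := norm_kernel_le a₀ a b t₀
  set q : ℝ := a₀.re + a.re - b.re - 1 with hq
  have hq1 : q < -1 := by rw [hq]; linarith
  have hcont : Continuous fun y : ℝ =>
      ‖Complex.Gamma (a₀ + (-(t₀ : ℂ) + (y : ℂ) * Complex.I)) * Complex.Gamma (a + (-(t₀ : ℂ) + (y : ℂ) * Complex.I)) *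
            Complex.Gamma (-(-(t₀ : ℂ) + (y : ℂ) * Complex.I)) /
          Complex.Gamma (b + (-(t₀ : ℂ) + (y : ℂ) * Complex.I))‖ * Real.exp (π * |y|) :=
    (continuous_kernel ht₀ ht₀' hta htb).norm.mul (by fun_prop)
  -- a bound on the compact middle part
  obtain ⟨M, hM⟩ := (isCompact_Icc : IsCompact (Icc (-R) R)).exists_bound_of_continuousOn hcont.continuousOn
  have hM0 : 0 ≤ M := le_trans (norm_nonneg _) (hM 0 (by constructor <;> linarith))
  -- the integrable majorant `C' (1+|y|)^q`
  set C' : ℝ := C * (2 : ℝ) ^ (-q) + M * (1 + R) ^ (-q) with hC'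
  have hmaj : Integrable fun y : ℝ => C' * (1 + ‖y‖) ^ (-(-q)) :=
    (integrable_one_add_norm (E := ℝ) (μ := volume) (by simp; linarith)).const_mul C'
  refine hmaj.mono' hcont.aestronglyMeasurable (Eventually.of_forall fun y => ?_)
  rw [Real.norm_eq_abs, abs_of_nonneg (by positivity), neg_neg, Real.norm_eq_abs]
  have h1y : 0 < 1 + |y| := by positivity
  by_cases hy : R ≤ |y|
  · -- tail: ‖K‖ e^{π|y|} ≤ C|y|^q ≤ C 2^{-q} (1+|y|)^q
    have hy1 : 1 ≤ |y| := le_trans hR hy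
    have hy0 : 0 < |y| := by linarith
    have hKy := hK y hy
    have hpow : |y| ^ q ≤ (2 : ℝ) ^ (-q) * (1 + |y|) ^ q := by
      have h2 : 1 + |y| ≤ 2 * |y| := by linarith
      have := Real.rpow_le_rpow_of_nonpos h1y h2 (by linarith : q ≤ 0)
      rw [Real.mul_rpow (by norm_num) (abs_nonneg y)] at this
      have h2q : (0 : ℝ) < 2 ^ q := Real.rpow_pos_of_pos (by norm_num) q
      rw [Real.rpow_neg (by norm_num : (0 : ℝ) ≤ 2)]
      calc |y| ^ q = (2 ^ q)⁻¹ * (2 ^ q * |y| ^ q) := by field_simp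
        _ ≤ (2 ^ q)⁻¹ * (1 + |y|) ^ q := mul_le_mul_of_nonneg_left this (by positivity)
    calc ‖Complex.Gamma (a₀ + (-(t₀ : ℂ) + (y : ℂ) * Complex.I)) * Complex.Gamma (a + (-(t₀ : ℂ) + (y : ℂ) * Complex.I)) *
              Complex.Gamma (-(-(t₀ : ℂ) + (y : ℂ) * Complex.I)) /
            Complex.Gamma (b + (-(t₀ : ℂ) + (y : ℂ) * Complex.I))‖ * Real.exp (π * |y|)
        ≤ (C * |y| ^ q * Real.exp (-(π * |y|))) * Real.exp (π * |y|) :=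
          mul_le_mul_of_nonneg_right hKy (Real.exp_pos _).le
      _ = C * |y| ^ q := by
          rw [mul_assoc, ← Real.exp_add, show -(π * |y|) + π * |y| = 0 by ring, Real.exp_zero, mul_one]
      _ ≤ C * ((2 : ℝ) ^ (-q) * (1 + |y|) ^ q) := mul_le_mul_of_nonneg_left hpow hC.le
      _ ≤ C' * (1 + |y|) ^ q := by
          rw [hC', add_mul, ← mul_assoc]
          have : 0 ≤ M * (1 + R) ^ (-q) * (1 + |y|) ^ q := by positivity
          linarith
  · -- middle: ≤ M ≤ M (1+R)^{-q} (1+|y|)^q since (1+|y|)^q ≥ (1+R)^q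
    rw [not_le] at hy
    have hyI : y ∈ Icc (-R) R := by
      constructor <;> linarith [neg_abs_le y, le_abs_self y]
    have hMy := hM y hyI
    rw [Real.norm_eq_abs, abs_of_nonneg (by positivity)] at hMy
    have hpow : (1 + R) ^ q ≤ (1 + |y|) ^ q := Real.rpow_le_rpow_of_nonpos h1y (by linarith) (by linarith)
    have hR0 : 0 < 1 + R := by linarith
    calc ‖Complex.Gamma (a₀ + (-(t₀ : ℂ) + (y : ℂ) * Complex.I)) * Complex.Gamma (a + (-(t₀ : ℂ) + (y : ℂ) * Complex.I)) *
              Complex.Gamma (-(-(t₀ : ℂ) + (y : ℂ) * Complex.I)) /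
            Complex.Gamma (b + (-(t₀ : ℂ) + (y : ℂ) * Complex.I))‖ * Real.exp (π * |y|)
        ≤ M := hMy
      _ = M * (1 + R) ^ (-q) * (1 + R) ^ q := by
          rw [mul_assoc, Real.rpow_neg hR0.le, inv_mul_cancel₀ (Real.rpow_pos_of_pos hR0 q).ne', mul_one]
      _ ≤ M * (1 + R) ^ (-q) * (1 + |y|) ^ q := mul_le_mul_of_nonneg_left hpow (by positivity)
      _ ≤ C' * (1 + |y|) ^ q := by
          rw [hC', add_mul]
          have : 0 ≤ C * (2 : ℝ) ^ (-q) * (1 + |y|) ^ q := by positivity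
          linarith

end Summit.KontsevichZagierPeriods.Zeta5Search.BarnesKernelBounds

end
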